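import Summits.BirchSwinnertonDyer.Rank1Residual.AdditivePotMult.TwistPointsOver
import Literature.NumberTheory.EllipticCurves.SubgroupSelmer
import HarnessLib

/-!
# The twist transport of Selmer LOCAL CONDITIONS over any Galois extension containing `√c` — kernel brick 2 (local half) of the transport [C] (cell `b2b-bsdres`, seat additive-p1, gen 8)

HONEST FRAMING (cell `b2b-bsdres`, run/shared/lean/b2b/bsd-rank1-residual/, verbatim in every
file): the goal of the cell is to DELETE the COMBINATION-SHAPED residual classes of the
Birch–Swinnerton-Dyer formula for ALL analytic-rank `≤ 1` elliptic curves over `ℚ` — "full BSD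
formula for every rank `≤ 1` curve in class `C`" assembled STRICTLY from published theorems — so
that the rank-`≤ 1` remainder becomes exactly the CONSTRUCTION-SHAPED classes, which are TYPED
(missing-input `Prop`s), NOT attempted. This is not "finishing BSD". The additive sub-cell (seats
additive-p1…p4) is a RESEARCH ROUTE on the construction-shaped classes X3/X4; sub-cell additive-p1
= the potentially MULTIPLICATIVE additive prime (X3♯(M) / X4(M)); no claim beyond the stated
classes; the labels of X3/X4 are UNCHANGED by this file; nothing is booked.

Definitions = concrete additive isomorphisms (no predicate, no named fact) and theorems. Context:
design HOME/b2b-bsdres-additive-p1/KERNEL-C-P3.md, brick 2. The sibling `TwistPointsOver.lean`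
built the twist substitution `E^{(c)}(A) ≃+ E(A)` for fields of characteristic `0` with their
CANONICAL `ℚ`-algebra structure; the local coefficient modules `localPoints W E = E(K̄_E)` (file
`Sha`) carry the TOWER structure of `AlgebraicClosure E`, equal to it only propositionally. §1–§2
re-run the construction for an ARBITRARY `ℚ`-algebra structure (suffix `Alg`, instance-generic
`VariableChange.baseChange_smul_eq`); §3 the local twist `twistLocalEquiv : E^{(c)}(ℚ̄_E) ≃+ E(ℚ̄_E)`
at the square root `ι(embIntoClosure θ)` — compatible with the coordinate maps
(`pointsMapOfEmb_twistGeomEquiv`) and `H_E`-EQUIVARIANT for `H ≤ galRange K`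
(`twistLocalEquiv_smul`); §4 `mem_localKerOverOfEmb_iff_twist` (local Selmer conditions
correspond, the tree's `mem_resKer_iff_h1Equiv_mem`) and **`twistSelmerEquiv :
Sel_{p^∞}(E^{(c)}/L) ≃+ Sel_{p^∞}(E/L)` for every Galois `L = ℚ̄^H ⊇ K = ℚ(√c)`** (all places, all
conjugates; the sign of the conjugation rule is invisible on membership).

References: Silverman, *AEC* (2009) X.5 Cor. 5.4 [SilvermanAEC2009]; T. Dokchitser (2013) §4
[Dokchitser2013ParityNotes]; Greenberg, LNM 1716 (1999) §2, §5 p. 143 [GreenbergLNM1716].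
-/

noncomputable section

open scoped Classical

universe u v

namespace Summit.BirchSwinnertonDyer.Rank1Residual.AdditivePotMult

open Literature.NumberTheory.EllipticCurves Literature.NumberTheory.GaloisRepresentations
  WeierstrassCurve

/-! ## §1 The substitution over an arbitrary `ℚ`-algebra field `A ∋ t`, `t² = c` (instance-generic twin of `TwistPointsOver` §1) -/

section Over

variable (W : WeierstrassCurve ℚ) {A : Type u} [Field A] [Algebra ℚ A] {t : A}
  {c : ℚ} (ht : t ∉ Set.range (algebraMap ℚ A)) (htc : t ^ 2 = algebraMap ℚ A c)

/-- Step 1: `E^{(c)}(A) ≃+ E^{(1)}(A)`, the substitution `u = t` (`twistUntwist`) followed by the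
transport along `u • E^{(c)}_A = E^{(1)}_A` (`twistUntwist_smul_baseChange`). Silverman, *AEC*,
X.5 Cor. 5.4. [cite: SilvermanAEC2009, X.5 Cor. 5.4] -/
def twistStepOneAlg :
    ((W.quadraticTwist c).baseChange A).toAffine.Point ≃+
      ((W.quadraticTwist 1).baseChange A).toAffine.Point :=
  (VariableChange.pointEquiv ((W.quadraticTwist c).baseChange A) (twistUntwist ht)).trans
    (Affine.Point.congrEquiv (twistUntwist_smul_baseChange W ht htc))

/-- `C_A • E_A = E^{(1)}_A` for the completed square `C = sqChange W` (rational coefficients),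
over ANY `ℚ`-algebra `A` (whatever its `ℚ`-algebra structure: `VariableChange.baseChange_smul_eq`).
[folklore] -/
theorem sqChange_map_smul_baseChange (A : Type u) [Field A] [Algebra ℚ A] :
    (sqChange W).map (algebraMap ℚ A) • W.baseChange A = (W.quadraticTwist 1).baseChange A := by
  rw [← VariableChange.baseChange_smul_eq, sqChange_spec]

/-- Step 2: `E(A) ≃+ E^{(1)}(A)`, the completed square `sqChange W` (rational coefficients) viewed
over `A`, followed by the transport along `C_A • E_A = E^{(1)}_A`. [folklore] -/
def twistStepTwoAlg :
    (W.baseChange A).toAffine.Point ≃+ ((W.quadraticTwist 1).baseChange A).toAffine.Point :=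
  (VariableChange.pointEquiv (W.baseChange A) ((sqChange W).map (algebraMap ℚ A))).trans
    (Affine.Point.congrEquiv (sqChange_map_smul_baseChange W A))

/-- **The twist substitution `Φ_A : E^{(c)}(A) ≃+ E(A)` over any field `A ⊇ ℚ` containing a square
root `t ∉ ℚ` of `c`** (`(X, Y) ↦ (X/t², Y/t³)` onto `E^{(1)}`, then un-completing the square).
Silverman, *AEC*, X.2 Prop. 2.4, X.5 Cor. 5.4. [cite: SilvermanAEC2009, X.5 Cor. 5.4] -/
def twistPointEquivAlg :
    ((W.quadraticTwist c).baseChange A).toAffine.Point ≃+ (W.baseChange A).toAffine.Point :=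
  (twistStepOneAlg W ht htc).trans (twistStepTwoAlg W (A := A)).symm

/-- Step 1 on an affine point. [folklore] -/
theorem twistStepOneAlg_some {x y : A}
    (h : ((W.quadraticTwist c).baseChange A).toAffine.Nonsingular x y) :
    twistStepOneAlg W ht htc (.some x y h) =
      .some ((twistUntwist ht).toX x) ((twistUntwist ht).toY x y)
        ((twistUntwist_smul_baseChange W ht htc) ▸
          (VariableChange.nonsingular_iff _ (twistUntwist ht) x y).mpr h) := by
  simp only [twistStepOneAlg, AddEquiv.trans_apply, VariableChange.pointEquiv_some,
    Affine.Point.congrEquiv_some]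

/-- Step 2 on an affine point. [folklore] -/
theorem twistStepTwoAlg_some {x y : A} (h : (W.baseChange A).toAffine.Nonsingular x y) :
    twistStepTwoAlg W (.some x y h) =
      .some (((sqChange W).map (algebraMap ℚ A)).toX x)
        (((sqChange W).map (algebraMap ℚ A)).toY x y)
        ((sqChange_map_smul_baseChange W A) ▸
          (VariableChange.nonsingular_iff _ ((sqChange W).map (algebraMap ℚ A)) x y).mpr h) := by
  simp only [twistStepTwoAlg, AddEquiv.trans_apply, VariableChange.pointEquiv_some,
    Affine.Point.congrEquiv_some]

/-- `Φ_A = (step 2)⁻¹ ∘ (step 1)`. [folklore] -/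
theorem twistPointEquivAlg_apply (P : ((W.quadraticTwist c).baseChange A).toAffine.Point) :
    twistPointEquivAlg W ht htc P = (twistStepTwoAlg W (A := A)).symm (twistStepOneAlg W ht htc P) :=
  rfl

/-- The `x`-coordinate of step 1: `u⁻² X = t⁻² X`. [folklore] -/
theorem toX_twistUntwistAlg (x : A) : (twistUntwist ht).toX x = t⁻¹ ^ 2 * x := by
  simp only [VariableChange.toX_def, twistUntwist, sub_zero, Units.val_inv_eq_inv_val,
    Units.val_mk0]

/-- The `y`-coordinate of step 1: `u⁻³ Y = t⁻³ Y`. [folklore] -/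
theorem toY_twistUntwistAlg (x y : A) : (twistUntwist ht).toY x y = t⁻¹ ^ 3 * y := by
  simp only [VariableChange.toY_def, twistUntwist, sub_zero, zero_mul,
    Units.val_inv_eq_inv_val, Units.val_mk0]

end Over

/-! ## §2 Naturality in the field (instance-generic) -/

section Natural

variable (W : WeierstrassCurve ℚ) {A : Type u} [Field A] [Algebra ℚ A] {t : A}
  {c : ℚ} (ht : t ∉ Set.range (algebraMap ℚ A)) (htc : t ^ 2 = algebraMap ℚ A c)
  {B : Type v} [Field B] [Algebra ℚ B] {t' : B}
  (ht' : t' ∉ Set.range (algebraMap ℚ B)) (htc' : t' ^ 2 = algebraMap ℚ B c)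
  (f : A →ₐ[ℚ] B)

/-- Step 2 is natural in the field (its coefficients are rational: `map_toX`, `map_toY`).
[folklore] -/
theorem map_twistStepTwoAlg (P : (W.baseChange A).toAffine.Point) :
    Affine.Point.map f (twistStepTwoAlg W P) = twistStepTwoAlg W (Affine.Point.map f P) := by
  rcases P with _ | ⟨x, y, h⟩
  · simp only [← Affine.Point.zero_def, map_zero]
  · rw [twistStepTwoAlg_some, Affine.Point.map_some, Affine.Point.map_some, twistStepTwoAlg_some]
    simp only [VariableChange.map_toX, VariableChange.map_toY]

/-- Step 1 is natural along `f` with `f t = t'`. [folklore] -/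
theorem map_twistStepOneAlg (hft : f t = t')
    (P : ((W.quadraticTwist c).baseChange A).toAffine.Point) :
    Affine.Point.map f (twistStepOneAlg W ht htc P) =
      twistStepOneAlg W ht' htc' (Affine.Point.map f P) := by
  rcases P with _ | ⟨x, y, h⟩
  · simp only [← Affine.Point.zero_def, map_zero]
  · rw [twistStepOneAlg_some, Affine.Point.map_some, Affine.Point.map_some, twistStepOneAlg_some]
    have hX := toX_twistUntwistAlg ht x
    have hY := toY_twistUntwistAlg ht x y
    have hX' := toX_twistUntwistAlg ht' (f x)
    have hY' := toY_twistUntwistAlg ht' (f x) (f y)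
    simp only [Affine.Point.some.injEq]
    refine ⟨?_, ?_⟩
    · rw [hX, hX', map_mul, map_pow, map_inv₀, hft]
    · rw [hY, hY', map_mul, map_pow, map_inv₀, hft]

/-- Step 1 is ANTI-natural along `f` with `f t = −t'`: the `y`-coordinate changes sign, which
is negation on the completed-square model `E^{(1)}` (`negY = −y` there). [folklore] -/
theorem map_twistStepOneAlg_of_neg (hft : f t = -t')
    (P : ((W.quadraticTwist c).baseChange A).toAffine.Point) :
    Affine.Point.map f (twistStepOneAlg W ht htc P) =
      -twistStepOneAlg W ht' htc' (Affine.Point.map f P) := by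
  rcases P with _ | ⟨x, y, h⟩
  · simp only [← Affine.Point.zero_def, map_zero, neg_zero]
  · rw [twistStepOneAlg_some, Affine.Point.map_some, Affine.Point.map_some, twistStepOneAlg_some,
      Affine.Point.neg_some]
    have hX := toX_twistUntwistAlg ht x
    have hY := toY_twistUntwistAlg ht x y
    have hX' := toX_twistUntwistAlg ht' (f x)
    have hY' := toY_twistUntwistAlg ht' (f x) (f y)
    simp only [Affine.Point.some.injEq]
    rw [QuadraticDescent.negY_quadraticTwist_one_baseChange]
    refine ⟨?_, ?_⟩
    · rw [hX, hX', map_mul, map_pow, map_inv₀, hft]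
      ring
    · rw [hY, hY', map_mul, map_pow, map_inv₀, hft]
      ring

/-- **Naturality of the twist substitution**: for a `ℚ`-algebra map `f : A → B` with
`f t = t'`, `f_* (Φ_A P) = Φ_B (f_* P)`. [folklore] -/
theorem map_twistPointEquivAlg (hft : f t = t')
    (P : ((W.quadraticTwist c).baseChange A).toAffine.Point) :
    Affine.Point.map f (twistPointEquivAlg W ht htc P) =
      twistPointEquivAlg W ht' htc' (Affine.Point.map f P) := by
  rw [twistPointEquivAlg_apply, twistPointEquivAlg_apply]
  apply (twistStepTwoAlg W (A := B)).injective
  rw [AddEquiv.apply_symm_apply, ← map_twistStepTwoAlg, AddEquiv.apply_symm_apply,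
    map_twistStepOneAlg W ht htc ht' htc' f hft]

/-- **Anti-naturality**: for `f : A → B` with `f t = −t'`, `f_* (Φ_A P) = −Φ_B (f_* P)` — the
Galois action on `E^{(c)}` is that on `E` twisted by the quadratic character. T. Dokchitser 2013,
§4. [cite: Dokchitser2013ParityNotes, §4] -/
theorem map_twistPointEquivAlg_of_neg (hft : f t = -t')
    (P : ((W.quadraticTwist c).baseChange A).toAffine.Point) :
    Affine.Point.map f (twistPointEquivAlg W ht htc P) =
      -twistPointEquivAlg W ht' htc' (Affine.Point.map f P) := by
  rw [twistPointEquivAlg_apply, twistPointEquivAlg_apply]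
  apply (twistStepTwoAlg W (A := B)).injective
  rw [map_neg, AddEquiv.apply_symm_apply, ← map_twistStepTwoAlg, AddEquiv.apply_symm_apply,
    map_twistStepOneAlg_of_neg W ht htc ht' htc' f hft]

end Natural


/-! ## §3 The local twist at one place: `E^{(c)}(ℚ̄_E) ≃+ E(ℚ̄_E)` along an embedding `ι : ℚ̄ → ℚ̄_E` -/

section Local

variable (W : WeierstrassCurve ℚ) (K : Type) [Field K] [NumberField K]
  (h2 : Module.finrank ℚ K = 2) {θ : K} {c : ℚ} (hθ : θ ∉ Set.range (algebraMap ℚ K))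
  (hc : θ ^ 2 = algebraMap ℚ K c)
  {E : Type} [Field E] [Algebra ℚ E] (ι : AlgebraicClosure ℚ →ₐ[ℚ] AlgebraicClosure E)

include hθ in
/-- `ι t ∉ ℚ` for the square root `t = embIntoClosure K θ ∈ ℚ̄`. [folklore] -/
theorem map_rootInClosure_not_mem :
    ι (rootInClosure K θ) ∉ Set.range (algebraMap ℚ (AlgebraicClosure E)) := by
  rintro ⟨q, hq⟩
  apply rootInClosure_not_mem K hθ
  refine ⟨q, ι.toRingHom.injective ?_⟩
  change ι (algebraMap ℚ (AlgebraicClosure ℚ) q) = ι (rootInClosure K θ)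
  rw [AlgHom.commutes]
  exact hq

include hc in
/-- `(ι t)² = c`. [folklore] -/
theorem map_rootInClosure_sq :
    ι (rootInClosure K θ) ^ 2 = algebraMap ℚ (AlgebraicClosure E) c := by
  rw [← map_pow, rootInClosure_sq K hc, AlgHom.commutes]

/-- `twistGeomEquiv` is the instance-generic substitution at `A = ℚ̄` (definitional). [folklore] -/
theorem twistGeomEquiv_eq_twistPointEquivAlg :
    twistGeomEquiv W K hθ hc =
      twistPointEquivAlg W (A := AlgebraicClosure ℚ) (rootInClosure_not_mem K hθ)
        (rootInClosure_sq K hc) :=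
  rfl

/-- **The local twist isomorphism `Φ_E : E^{(c)}(ℚ̄_E) ≃+ E(ℚ̄_E)`** at the square root `ι t`, for
the tree's local coefficient modules `localPoints` (tower `ℚ`-algebra structure on `ℚ̄_E`).
Silverman, *AEC*, X.§4, X.5 Cor. 5.4. [cite: SilvermanAEC2009, X.5 Cor. 5.4] -/
def twistLocalEquiv : localPoints (W.quadraticTwist c) E ≃+ localPoints W E :=
  twistPointEquivAlg W (A := AlgebraicClosure E) (map_rootInClosure_not_mem K hθ ι)
    (map_rootInClosure_sq K hc ι)

/-- **The local square** `ι_* ∘ Φ_ℚ̄ = Φ_E ∘ ι_*` (`pointsMapOfEmb = Point.map ι`). [folklore] -/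
theorem pointsMapOfEmb_twistGeomEquiv (P : geomPoints (W.quadraticTwist c)) :
    pointsMapOfEmb W ι (twistGeomEquiv W K hθ hc P) =
      twistLocalEquiv W K hθ hc ι (pointsMapOfEmb (W.quadraticTwist c) ι P) := by
  rw [twistGeomEquiv_eq_twistPointEquivAlg]
  exact map_twistPointEquivAlg W (rootInClosure_not_mem K hθ) (rootInClosure_sq K hc)
    (map_rootInClosure_not_mem K hθ ι) (map_rootInClosure_sq K hc ι) ι rfl P

variable {H : Subgroup (Field.absoluteGaloisGroup ℚ)} (hH : H ≤ galRange (K := ℚ) K)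

include hH in
/-- An element of the local subgroup `H_E` (`H ≤ galRange K`) fixes `ι t`: its restriction to
`ℚ̄` lies in `H ≤ Gal(ℚ̄/K)` and `ι ∘ (τ|_ℚ̄) = τ ∘ ι` (`comp_resGalAuxOfEmb`). [folklore] -/
theorem localSubgroup_apply_map_rootInClosure (τ : localSubgroupOfEmb H ι) :
    ((AlgEquiv.restrictScalars ℚ
        (show AlgebraicClosure E ≃ₐ[E] AlgebraicClosure E from (τ : Field.absoluteGaloisGroup E)) :
          AlgebraicClosure E ≃ₐ[ℚ] AlgebraicClosure E) :
        AlgebraicClosure E →ₐ[ℚ] AlgebraicClosure E) (ι (rootInClosure K θ)) =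
      ι (rootInClosure K θ) := by
  have hmem : resGalOfEmb ι (τ : Field.absoluteGaloisGroup E) ∈ galRange (K := ℚ) K :=
    hH ((mem_localSubgroupOfEmb_iff H ι _).mp τ.2)
  have hfix := apply_rootInClosure_of_mem K (θ := θ) hmem
  have hsq := DFunLike.congr_fun (comp_resGalAuxOfEmb ι (τ : Field.absoluteGaloisGroup E))
    (rootInClosure K θ)
  rw [AlgHom.comp_apply, AlgHom.comp_apply] at hsq
  exact hsq.symm.trans (congrArg ι hfix)

include hH in
/-- **`H_E`-equivariance of the local twist**: `Φ_E (τ • Q) = τ • Φ_E Q` for `τ ∈ H_E`,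
`H ≤ galRange K` (`τ` acts on coordinates by an automorphism fixing `ι t`). [folklore] -/
theorem twistLocalEquiv_smul (τ : localSubgroupOfEmb H ι) (Q : localPoints (W.quadraticTwist c) E) :
    twistLocalEquiv W K hθ hc ι (τ • Q) = τ • twistLocalEquiv W K hθ hc ι Q := by
  rw [Subgroup.smul_def, Subgroup.smul_def, localPoints.smul_def, localPoints.smul_def]
  exact (map_twistPointEquivAlg W (map_rootInClosure_not_mem K hθ ι) (map_rootInClosure_sq K hc ι)
    (map_rootInClosure_not_mem K hθ ι) (map_rootInClosure_sq K hc ι) _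
    (localSubgroup_apply_map_rootInClosure K ι hH τ) Q).symm

end Local

/-! ## §4 The Selmer local conditions and `Sel_{p^∞}` over `L ⊇ K` correspond under the twist -/

section Selmer

variable (W : WeierstrassCurve ℚ) (K : Type) [Field K] [NumberField K]
  (h2 : Module.finrank ℚ K = 2) {θ : K} {c : ℚ} (hθ : θ ∉ Set.range (algebraMap ℚ K))
  (hc : θ ^ 2 = algebraMap ℚ K c) (p : ℕ)
  (H : Subgroup (Field.absoluteGaloisGroup ℚ)) (hH : H ≤ galRange (K := ℚ) K)

/-- `ψ̃_* : H¹(H, E^{(c)}[p^∞]) ≃+ H¹(H, E[p^∞])` induced by `twistPrimaryEquiv`. [folklore] -/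
def twistSubgroupH1EquivGeom : (W.quadraticTwist c).subgroupH1 p H ≃+ W.subgroupH1 p H :=
  h1Equiv (G := H) (twistPrimaryEquiv W K hθ hc p) (twistPrimaryEquiv_smul_of_le W K hθ hc p hH)

/-- **The local Selmer condition at the place singled out by `ι` corresponds under `ψ̃_*`.**
For every `ℚ`-field `E` (a completion `ℚ_v`) and `ℚ`-embedding `ι : ℚ̄ → ℚ̄_E`: a class of
`H¹(H, E^{(c)}[p^∞])` dies in `H¹(H_E, E^{(c)}(ℚ̄_E))` iff its image dies in
`H¹(H_E, E(ℚ̄_E))` — the tree's `mem_resKer_iff_h1Equiv_mem` for the square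
`ι_* ∘ ψ̃ = Φ_E ∘ ι_*` with `Φ_E` `H_E`-equivariant (§3). Greenberg (1999), §2.
[cite: GreenbergLNM1716, §2] -/
theorem mem_localKerOverOfEmb_iff_twist {E : Type} [Field E] [Algebra ℚ E]
    (ι : AlgebraicClosure ℚ →ₐ[ℚ] AlgebraicClosure E) (s : (W.quadraticTwist c).subgroupH1 p H) :
    s ∈ (W.quadraticTwist c).localKerOverOfEmb p H ι ↔
      twistSubgroupH1EquivGeom W K hθ hc p H hH s ∈ W.localKerOverOfEmb p H ι := by
  change s ∈ resKer _ _ _ ↔ h1Equiv _ _ s ∈ resKer _ _ _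
  exact mem_resKer_iff_h1Equiv_mem (resGalSubgroupOfEmb H ι)
    ((pointsMapOfEmb (W.quadraticTwist c) ι).comp
      ((W.quadraticTwist c).geomPrimaryTorsion p).subtype) _
    ((pointsMapOfEmb W ι).comp (W.geomPrimaryTorsion p).subtype) _
    (twistPrimaryEquiv W K hθ hc p) (twistPrimaryEquiv_smul_of_le W K hθ hc p hH)
    (twistLocalEquiv W K hθ hc ι) (fun τ Q ↦ twistLocalEquiv_smul W K hθ hc ι hH τ Q)
    (fun m ↦ pointsMapOfEmb_twistGeomEquiv W K hθ hc ι m) s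

/-- The same for the chosen embedding (`localKerOver`). [cite: GreenbergLNM1716, §2] -/
theorem mem_localKerOver_iff_twist (E : Type) [Field E] [Algebra ℚ E]
    (s : (W.quadraticTwist c).subgroupH1 p H) :
    s ∈ (W.quadraticTwist c).localKerOver p H E ↔
      twistSubgroupH1EquivGeom W K hθ hc p H hH s ∈ W.localKerOver p H E := by
  rw [localKerOver_eq_ofEmb, localKerOver_eq_ofEmb]
  exact mem_localKerOverOfEmb_iff_twist W K hθ hc p H hH _ s

variable [H.Normal]

include h2 in
/-- **Conjugation rule for `ψ̃_*`, up to sign**: for every `σ ∈ Γ_ℚ`,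
`ψ̃_* (σ_* s) = ± σ_* (ψ̃_* s)` (`+` on `galRange K`, `−` off it). [folklore] -/
theorem twistSubgroupH1EquivGeom_conjH1 (σ : Field.absoluteGaloisGroup ℚ)
    (s : (W.quadraticTwist c).subgroupH1 p H) :
    twistSubgroupH1EquivGeom W K hθ hc p H hH ((W.quadraticTwist c).conjH1 p H σ s) =
        W.conjH1 p H σ (twistSubgroupH1EquivGeom W K hθ hc p H hH s) ∨
      twistSubgroupH1EquivGeom W K hθ hc p H hH ((W.quadraticTwist c).conjH1 p H σ s) =
        -W.conjH1 p H σ (twistSubgroupH1EquivGeom W K hθ hc p H hH s) := by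
  obtain ⟨f, rfl⟩ := oneCocycleClass_surjective _ s
  by_cases hσ : σ ∈ galRange (K := ℚ) K
  · left
    change h1Equiv _ _ (conjH1 H _ σ _) = conjH1 H _ σ (h1Equiv _ _ _)
    rw [conjH1_oneCocycleClass, h1Equiv_apply, h1Equiv_apply, resH1Hom_id_oneCocycleClass,
      resH1Hom_id_oneCocycleClass, conjH1_oneCocycleClass]
    congr 1
    apply Subtype.ext
    ext n : 1
    rw [contOneCocycles.push_apply, conjCocycle_apply]
    change twistPrimaryEquiv W K hθ hc p (σ • f.1 (subgroupConj H σ n)) =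
      (conjCocycle H σ (contOneCocycles.push
        (twistPrimaryEquiv W K hθ hc p : _ →+ _) (twistPrimaryEquiv_smul_of_le W K hθ hc p hH) f)).1 n
    rw [conjCocycle_apply, contOneCocycles.push_apply]
    exact twistPrimaryEquiv_smul_of_mem W K hθ hc p hσ _
  · right
    exact h1Equiv_conjH1_neg (N := H) (twistPrimaryEquiv W K hθ hc p)
      (twistPrimaryEquiv_smul_of_le W K hθ hc p hH)
      (fun m ↦ twistPrimaryEquiv_smul_of_not_mem W K h2 hθ hc p hσ m) _

include h2 in
/-- **`Sel_{p^∞}(E^{(c)}/L) ≅ Sel_{p^∞}(E/L)` for every Galois `L = ℚ̄^H ⊇ K = ℚ(√c)`**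
(subgroup model; all places of `ℚ`, all conjugates): `s ∈ Sel_{p^∞}(E^{(c)}/L)` iff
`ψ̃_* s ∈ Sel_{p^∞}(E/L)`. The conjugation rule holds up to a sign, which membership in a
subgroup does not see. With `TwistPointsOver` §3 / `TwistTransportH1` (the sign rule) and
`PrimeToPDescent` (brick 1) this is the Selmer-level transport of [C]:
`Sel_{p^∞}(E^{(c)}/ℚ_∞) ≅ Sel_{p^∞}(E/K·ℚ_∞)^{−}`. T. Dokchitser 2013, §4; Greenberg (1999), §2,
§5 p. 143. [cite: Dokchitser2013ParityNotes, §4] -/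
theorem mem_selmerGroupOver_iff_twist (s : (W.quadraticTwist c).subgroupH1 p H) :
    s ∈ (W.quadraticTwist c).selmerGroupOver p H ↔
      twistSubgroupH1EquivGeom W K hθ hc p H hH s ∈ W.selmerGroupOver p H := by
  rw [mem_selmerGroupOver_iff, mem_selmerGroupOver_iff]
  have key : ∀ (σ : Field.absoluteGaloisGroup ℚ) (E : Type) [Field E] [Algebra ℚ E],
      (W.quadraticTwist c).conjH1 p H σ s ∈ (W.quadraticTwist c).localKerOver p H E ↔
        W.conjH1 p H σ (twistSubgroupH1EquivGeom W K hθ hc p H hH s) ∈ W.localKerOver p H E := by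
    intro σ E _ _
    rw [mem_localKerOver_iff_twist W K hθ hc p H hH E]
    rcases twistSubgroupH1EquivGeom_conjH1 W K h2 hθ hc p H hH σ s with h | h
    · rw [h]
    · rw [h, neg_mem_iff]
  exact ⟨fun h ↦ ⟨fun v σ ↦ (key σ _).mp (h.1 v σ), fun w σ ↦ (key σ _).mp (h.2 w σ)⟩,
    fun h ↦ ⟨fun v σ ↦ (key σ _).mpr (h.1 v σ), fun w σ ↦ (key σ _).mpr (h.2 w σ)⟩⟩

/-- **The twist isomorphism of Selmer groups `Sel_{p^∞}(E^{(c)}/L) ≃+ Sel_{p^∞}(E/L)`** for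
`L = ℚ̄^H ⊇ K` Galois over `ℚ`. [cite: Dokchitser2013ParityNotes, §4] -/
def twistSelmerEquiv :
    (W.quadraticTwist c).selmerGroupOver p H ≃+ W.selmerGroupOver p H where
  toFun s := ⟨twistSubgroupH1EquivGeom W K hθ hc p H hH s,
    (mem_selmerGroupOver_iff_twist W K h2 hθ hc p H hH s).mp s.2⟩
  invFun s := ⟨(twistSubgroupH1EquivGeom W K hθ hc p H hH).symm s, by
    have h := (mem_selmerGroupOver_iff_twist W K h2 hθ hc p H hH
      ((twistSubgroupH1EquivGeom W K hθ hc p H hH).symm s)).mpr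
    rw [AddEquiv.apply_symm_apply] at h
    exact h s.2⟩
  left_inv s := Subtype.ext ((twistSubgroupH1EquivGeom W K hθ hc p H hH).symm_apply_apply _)
  right_inv s := Subtype.ext ((twistSubgroupH1EquivGeom W K hθ hc p H hH).apply_symm_apply _)
  map_add' s s' := Subtype.ext (map_add _ _ _)

end Selmer

end Summit.BirchSwinnertonDyer.Rank1Residual.AdditivePotMult

end
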